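import Mathlib
import HarnessLib
import Summits.HubbardSuperconductivity.HubbardSuperconductivity.Theorems.KLProgrammeKLRegimeEngineFrameShiftDensityResponse

/-!
# K3 gen-8-FLOW (stmt 20437, stub (C), «(C)-B-REP» composition input): the frequency sum of the SQUARED symbol above the shell is log-free —
# `Σ_i Ψ_e(ω_i)² = −c²·T′_M(e)`, `‖Σ_i Ψ_e(ω_i)²‖ ≤ c²·(β²/(2π²M) + 2π²/(β|e|³))`

Cell gate-hubbard-kl, seat p2 g12.  In k3c4-p2's frame-mismatch identity (`…TwoVolumeFrameMismatchResum.klSelfEnergy_frame_sub_eq_mismatch_add_response`) the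
symbol difference is `Ψ̃ − Ψ_{K₁} = (Ψ_{K₂} − Ψ_{K₁}) + (Ψ̃ − Ψ_{K₂})` with `Ψ̃ − Ψ_{K₂} = −Ψ_{K₂}²·δK/(βL²)·(1 + …)⁻¹`; the bare tadpole of the corrected (B) door
therefore also needs the SIGNED frequency sum of `Ψ²`.  Above the shell (`Λ ≤ |e|`, weight `≡ 1`) `Ψ_e(ω)² = c²/(−iω + e)² = c²((e² − ω²) + 2ieω)/(ω² + e²)²`;
the odd part cancels over the symmetric frequency set and the even part is `−c²` times the truncated density derivative of `…MatsubaraDensityDerivative`: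

* `resolventFn_sq_eq` — the pointwise real/imaginary split;  `sum_resolventFn_sq_matsubara_eq` — `Σ_i (c/(−iω_i+e))² = −c²·Σ_i (ω_i²−e²)/(ω_i²+e²)²`;
* **`norm_sum_uvSymbolFn_sq_le`** — `‖Σ_i Ψ_e(ω_i)²‖ ≤ c²·(β²/(2π²M) + 2π²/(β·|e|³))` for `Λ ≤ |e|`, `1 ≤ M` (by `abs_sum_matsubaraIdx_densityDeriv_le`).

Proofs only.  References: BGM 2006 §2.1 [cite: BenfattoGiulianiMastropietro2006]; Giuliani–Mastropietro 2010 App. A (A.21).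
-/

noncomputable section

namespace Summit.HubbardSuperconductivity.HubbardSuperconductivity.Theorems.EngineV8

set_option linter.dupNamespace false -- summit = problem name (single-conjunct summit), D-0017

open Finset Real Literature.MathematicalPhysics.QuantumLattice

/-- Pointwise: `(c/(−iω + e))² = c²(e² − ω²)/(ω² + e²)² + i·(2c²eω/(ω² + e²)²)` (`ω ≠ 0`). -/
theorem resolventFn_sq_eq (c e : ℝ) {ω : ℝ} (hω : ω ≠ 0) :
    resolventFn c 0 e ω ^ 2 =
      ((c ^ 2 * (e ^ 2 - ω ^ 2) / (ω ^ 2 + e ^ 2) ^ 2 : ℝ) : ℂ) + ((2 * c ^ 2 * e * ω / (ω ^ 2 + e ^ 2) ^ 2 : ℝ) : ℂ) * Complex.I := by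
  have hden : 0 < ω ^ 2 + e ^ 2 := by positivity
  have hd : (-Complex.I * ((ω : ℝ) : ℂ) + (e : ℂ)) ≠ 0 := by
    intro h
    have := congrArg Complex.im h
    simp at this
    exact hω this
  have hdenC : ((ω : ℂ) ^ 2 + (e : ℂ) ^ 2) ≠ 0 := by exact_mod_cast hden.ne'
  have hd2 : (-Complex.I * ((ω : ℝ) : ℂ) + (e : ℂ)) ^ 2 ≠ 0 := pow_ne_zero 2 hd
  have hR : ((c ^ 2 * (e ^ 2 - ω ^ 2) / (ω ^ 2 + e ^ 2) ^ 2 : ℝ) : ℂ) + ((2 * c ^ 2 * e * ω / (ω ^ 2 + e ^ 2) ^ 2 : ℝ) : ℂ) * Complex.I =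
      (c : ℂ) ^ 2 * (((e : ℂ) ^ 2 - (ω : ℂ) ^ 2) + 2 * (e : ℂ) * (ω : ℂ) * Complex.I) / ((ω : ℂ) ^ 2 + (e : ℂ) ^ 2) ^ 2 := by
    push_cast
    field_simp
  rw [hR, resolventFn, add_zero, div_pow, div_eq_div_iff hd2 (pow_ne_zero 2 hdenC)]
  linear_combination ((c : ℂ) ^ 2 * (ω : ℂ) ^ 2 * ((ω : ℂ) ^ 2 + 3 * (e : ℂ) ^ 2 - 2 * (ω : ℂ) * (e : ℂ) * Complex.I)) * Complex.I_sq

/-- **`Σ_i (c/(−iω_i + e))² = −c²·Σ_i (ω_i² − e²)/(ω_i² + e²)²`** (the odd part cancels over the symmetric frequency set; `β ≠ 0`). -/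
theorem sum_resolventFn_sq_matsubara_eq {β : ℝ} (hβ : β ≠ 0) (c e : ℝ) (M : ℕ) :
    ∑ i : MatsubaraIdx M, resolventFn c 0 e (matsubaraFreq β M i) ^ 2 =
      ((-c ^ 2 * ∑ i : MatsubaraIdx M, (matsubaraFreq β M i ^ 2 - e ^ 2) / (matsubaraFreq β M i ^ 2 + e ^ 2) ^ 2 : ℝ) : ℂ) := by
  have hterm : ∀ i : MatsubaraIdx M, resolventFn c 0 e (matsubaraFreq β M i) ^ 2 =
      ((c ^ 2 * (e ^ 2 - matsubaraFreq β M i ^ 2) / (matsubaraFreq β M i ^ 2 + e ^ 2) ^ 2 : ℝ) : ℂ) +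
        ((2 * c ^ 2 * e * matsubaraFreq β M i / (matsubaraFreq β M i ^ 2 + e ^ 2) ^ 2 : ℝ) : ℂ) * Complex.I :=
    fun i => resolventFn_sq_eq c e (matsubaraFreq_ne_zero hβ i)
  simp_rw [hterm]
  rw [sum_add_distrib, ← sum_mul]
  -- the odd part vanishes
  have hodd : ∑ i : MatsubaraIdx M, (((2 * c ^ 2 * e * matsubaraFreq β M i / (matsubaraFreq β M i ^ 2 + e ^ 2) ^ 2 : ℝ)) : ℂ) = 0 := by
    have h := sum_matsubaraIdx_reflect β M (fun ω => (((2 * c ^ 2 * e * ω / (ω ^ 2 + e ^ 2) ^ 2 : ℝ)) : ℂ))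
    have hneg : ∑ i : MatsubaraIdx M, (((2 * c ^ 2 * e * (-matsubaraFreq β M i) / ((-matsubaraFreq β M i) ^ 2 + e ^ 2) ^ 2 : ℝ)) : ℂ) =
        -∑ i : MatsubaraIdx M, (((2 * c ^ 2 * e * matsubaraFreq β M i / (matsubaraFreq β M i ^ 2 + e ^ 2) ^ 2 : ℝ)) : ℂ) := by
      rw [← sum_neg_distrib]
      refine sum_congr rfl fun i _ => ?_
      rw [neg_sq, ← Complex.ofReal_neg]
      congr 1
      ring
    rw [hneg] at h
    -- h : S = -S
    have h2 : (2 : ℂ) * ∑ i : MatsubaraIdx M, (((2 * c ^ 2 * e * matsubaraFreq β M i / (matsubaraFreq β M i ^ 2 + e ^ 2) ^ 2 : ℝ)) : ℂ) = 0 := by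
      rw [two_mul]
      nth_rewrite 2 [h]
      ring
    exact (mul_eq_zero.1 h2).resolve_left two_ne_zero
  rw [hodd, zero_mul, add_zero]
  push_cast
  rw [mul_sum]
  refine sum_congr rfl fun i _ => ?_
  ring

/-- **THE SQUARED SYMBOL SUMS LOG-FREE ABOVE THE SHELL**: `Λ ≤ |e|`, `0 < β`, `0 < Λ`, `1 ≤ M` ⟹
`‖Σ_i Ψ_e(ω_i)²‖ ≤ c²·(β²/(2π²M) + 2π²/(β·|e|³))`. -/
theorem norm_sum_uvSymbolFn_sq_le {β : ℝ} (hβ : 0 < β) {M : ℕ} (hM : 1 ≤ M) {Λ : ℝ} (hΛ : 0 < Λ) (c : ℝ) {e : ℝ} (he : Λ ≤ |e|) :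
    ‖∑ i : MatsubaraIdx M, uvSymbolFn c Λ e (matsubaraFreq β M i) ^ 2‖ ≤ c ^ 2 * (β ^ 2 / (2 * π ^ 2 * M) + 2 * π ^ 2 / (β * |e| ^ 3)) := by
  have he0 : e ≠ 0 := by
    intro h0; rw [h0, abs_zero] at he; linarith
  have hW : ∀ i : MatsubaraIdx M, uvSymbolFn c Λ e (matsubaraFreq β M i) = resolventFn c 0 e (matsubaraFreq β M i) := by
    intro i
    have hω : 0 < matsubaraFreq β M i ^ 2 := by
      have := matsubaraFreq_ne_zero hβ.ne' i
      positivity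
    have he2 : Λ ^ 2 ≤ e ^ 2 := by
      calc Λ ^ 2 ≤ |e| ^ 2 := pow_le_pow_left₀ hΛ.le he 2
        _ = e ^ 2 := sq_abs e
    rw [uvSymbolFn, (uvWeightFn_eq_one_of_gt hΛ (e := e) (ω := matsubaraFreq β M i) (by linarith)).1, Complex.ofReal_one, one_mul]
  simp_rw [hW]
  rw [sum_resolventFn_sq_matsubara_eq hβ.ne' c e M, Complex.norm_real, Real.norm_eq_abs, abs_mul, abs_neg, abs_pow, sq_abs]
  exact mul_le_mul_of_nonneg_left (abs_sum_matsubaraIdx_densityDeriv_le hβ hM he0) (sq_nonneg c)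

end Summit.HubbardSuperconductivity.HubbardSuperconductivity.Theorems.EngineV8

end
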